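import Summits.HodgeConjecture.HodgeConjecture.Theorems.FirstOrderSemiregularSeedsFirstOrderWeilSeedsEightCPad4Anchor
import Summits.HodgeConjecture.HodgeConjecture.Theorems.Ring2SemiregularRepresentativesVHC
import Literature.AlgebraicGeometry.KTheory.ChernCharacterPresentsAlgebraicClasses
import HarnessLib

/-!
# Route `FirstOrderSemiregularSeeds`, crux X2′ `FirstOrderWeilSeedsEightC` (item stmt-HodgeConjecture-23714), line `birthC`:
# the CLASS HALF `stub_kappaDesign_pad4` on the pinned CM anchor `S_d⁴` — MODULO ONE K-THEORETIC NAMED FACT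

HONEST FRAMING. Nothing here proves X2′, X1, rung H2, HC for abelian varieties or the Hodge conjecture. This is a
CONDITIONAL `--supports` helper for the registered stub `stub_kappaDesign_pad4` of
`Cruxes/FirstOrderWeilSeedsEight/Lines/birthC.lean` (be6186eb62c4); the stub's registered (unconditional) signature is
NOT closed by this file. Companion of `…FirstOrderWeilSeedsEightCPad4Anchor` (the UNCONDITIONAL anchor half:
hyperbolicity, the non-zero rational `(4,4)` Weil class, algebraicity of all rational Hodge classes of `S⁴`, and the
`K`-symmetrised re-embedding).

## What the stub asks, and the diagnosis

For every Chern-character theory `C : ChernCharacterBetti`, every `d > 0` and every CM datum `(E₀, ψ₀)` (`dim E₀ = 1`,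
`ψ₀² = -d`): on `P = ((S × S) × S) × S`, `S = E₀ × E₀`, `Ψ = (ψ₀ × (−ψ₀))⁴`, a projective embedding `e` and a rational
`a ≠ 0` making `(P, Ψ)` HYPERBOLIC for `h_K = d·e^*a + Ψ^*e^*a`, a non-zero rational class `w` of the `√-d`-Weil plane,
AND a finite locally free `E` on `P.X` with `ch_p(E) = c_p·h_Kᵖ` (`p ≠ 4`, `p ≤ 8`), `ch₄(E) = q·h_K⁴ + w`.

The f.l.f. κ-DESIGN is NOT constructible from the tree today, on ANY anchor: the fields of the hypothesis structure
`ChernCharacterBetti` determine `ch` only on free modules, pull-backs and extensions, and give the `ℂ`-span of the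
`ch_p(E)` ONE DEGREE AT A TIME (`algebraicClasses_le_span_ch`); the tree has no module `𝒪_X(D)` with a normalised `ch₁`,
no tensor product of modules, and no presentation of a TOTAL algebraic class by ONE vector bundle. Averaging pull-backs
over `Aut(E₀⁸)` cannot force `ch_p ∈ ℚ·h_Kᵖ` for `p ≠ 4` (the invariants contain `ℚ[θ_odd, θ_even]`), and pull-backs
from `ℙᴺ` carry no Weil component. What is missing is exactly the K-theoretic bookkeeping «`ch : K(X)_ℚ ⥲ A(X)_ℚ`
(Fulton Ex. 15.2.16 (b)) + Serre's theorem (a vector bundle embeds in `𝒪_X(m)^{⊕M}` with locally free quotient,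
Hartshorne II Thm. 5.17)», which is the NAMED FACT `Literature.AlgebraicGeometry.KTheory.Fulton1998_chernCharacter_presentsAlgebraicClasses`
(`Literature/AlgebraicGeometry/KTheory/ChernCharacterPresentsAlgebraicClasses`, rendered over `ChernCharacterBetti` exactly
as the tree renders Buchweitz–Flenner Thm. 5.1).

`kappaDesign_pad4_of_presentsAlgebraicClasses`: THE STUB for every object class `𝒪` containing the f.l.f. κ-designs
(the skeleton's `lfDesignClass C` qualifies by `fun _ _ _ h₁ h₂ h₃ ↦ ⟨h₁, h₂, h₃⟩`) and for the nested action given as a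
variable `Ψ` with its defining equation (`pad4Action E₀ ψ₀`, `rfl`), MODULO the named fact (the gate records
`proof.conditional`). In the skeleton,
`stub_kappaDesign_pad4 := fun C d hd E₀ ψ₀ hE hψ ↦ kappaDesign_pad4_of_presentsAlgebraicClasses hK C (lfDesignClass C)
(fun _ _ _ h₁ h₂ h₃ ↦ ⟨h₁, h₂, h₃⟩) hd hE hψ (pad4Action E₀ ψ₀) rfl` type-checks once `hK` is a hypothesis of the line.

## References

[cite: Fulton1998, Example 15.2.16 (b), §15.1, Cor. 19.2 (b)] [cite: Hartshorne1977, II Thm. 5.17]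
[cite: Markman2025SurveySecant, §11.5 Step 2] [cite: vanGeemen1994HodgeAV, 4.3, Lemma 5.2, 5.3]
-/

noncomputable section

-- single-problem summit (Problem = Summit): the mandated namespace repeats `HodgeConjecture`.
set_option linter.dupNamespace false

open CategoryTheory AlgebraicGeometry
open Literature.AlgebraicGeometry Literature.AlgebraicGeometry.Motives Literature.AlgebraicGeometry.HodgeTheory
open Literature.AlgebraicTopology.SingularHomology
open Summit.Ventures.HSemireg
open Literature.AlgebraicGeometry.KTheory (Fulton1998_chernCharacter_presentsAlgebraicClasses)

namespace Summit.HodgeConjecture.HodgeConjecture.Theorems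

/-! ## The class half of line `birthC` on the PAD-4 anchor, MODULO the named fact -/

section Seed

variable {E₀ : AbelianVariety ℂ} {ψ₀ : E₀ ⟶ E₀} {d : ℕ}

open Literature.AlgebraicGeometry.Motives.SegreHyperplaneClass in
/-- **THE CLASS HALF `stub_kappaDesign_pad4`, MODULO `Fulton1998_chernCharacter_presentsAlgebraicClasses`** (CONDITIONAL;
for every object class `𝒪` containing the finite-locally-free κ-designs of `C` in relative dimension `8` — the skeleton's
`lfDesignClass C` qualifies by `fun _ _ _ h₁ h₂ h₃ ↦ ⟨h₁, h₂, h₃⟩` — and for the nested action `Ψ = (ψ₀ × (−ψ₀))⁴` given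
with its defining equation, `pad4Action E₀ ψ₀` and `rfl` in the skeleton). For every Chern-character theory `C`, `d ≥ 1`
and CM datum `(E₀, ψ₀)`: on `S⁴` there are a projective embedding `e`, a rational `a ≠ 0` with `(S⁴, Ψ)` HYPERBOLIC for
`h_K = d·e^*a + Ψ^*e^*a`, a non-zero rational Weil class `w`, and an `𝒪`-seed for `q·h_K⁴ + w`. Proof: the anchor file
gives a hyperbolic `(e₀, a₀)` and a non-zero rational `(4,4)` Weil class `w₀`, algebraic at the anchor
(`pad4Anchor_hodgeClass_mem_algebraicClasses`); `exists_projectiveEmbedding_symmetrised` re-embeds so that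
`e^*a = μ·h_K(e₀, a₀)`, whence `h_K(e, a) = 2d·e^*a` (`Ψ^*h_K(e₀,a₀) = d·h_K(e₀,a₀)` from `Ψ^*Ψ^* = d²` on `H²`) and
hyperbolicity transfers (`isHyperbolicWeilType_smul_iff`); the named fact applied to `κ = (0,…,0,w₀,0,…)` and `(e, a)`
yields a finite locally free `F` with `ch₄(F) = N·w₀ + c₄·(e^*a)⁴`, `ch_p(F) = c_p·(e^*a)ᵖ` (`p ≠ 4`), i.e. an f.l.f.
κ-design for `(c₄/(2d)⁴)·h_K⁴ + N·w₀` with `ch_p = (c_p/(2d)ᵖ)·h_Kᵖ`; `w := N·w₀`. Nothing here is a first-order or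
semiregularity statement; HC is not proved. [cite: Fulton1998, Example 15.2.16 (b) and §15.1]
[cite: Markman2025SurveySecant, §11.5 Step 2] [cite: vanGeemen1994HodgeAV, 4.3, Lemma 5.2 and 5.3] -/
theorem kappaDesign_pad4_of_presentsAlgebraicClasses (hK : Fulton1998_chernCharacter_presentsAlgebraicClasses)
    (C : ChernCharacterBetti) (𝒪 : ObjClass)
    (h𝒪 : ∀ (X₀ : SchemeOver ℂ) (I : Finset ℕ) (κ : (p : ℕ) → complexBetti X₀ (2 * p)),
      I = Finset.range (2 * 4 + 1) → (∃ P₀ : AbelianVariety ℂ, Nonempty (X₀ ≅ P₀.X)) →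
      (∃ (F : X₀.left.Modules) (_ : IsFiniteLocallyFree F), ∀ p ∈ I, κ p = C.ch X₀ F p) → 𝒪 (2 * 4) X₀ I κ)
    (hd : 0 < d) (hE : E₀.dim = 1) (hψ : ψ₀ ≫ ψ₀ = -(d • 𝟙 E₀))
    (Ψ : (((E₀.prod E₀).prod (E₀.prod E₀)).prod (E₀.prod E₀)).prod (E₀.prod E₀) ⟶
      (((E₀.prod E₀).prod (E₀.prod E₀)).prod (E₀.prod E₀)).prod (E₀.prod E₀))
    (hΨ : Ψ = AbelianVariety.prodLift
        (AbelianVariety.fst (((E₀.prod E₀).prod (E₀.prod E₀)).prod (E₀.prod E₀)) (E₀.prod E₀) ≫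
          AbelianVariety.prodLift
            (AbelianVariety.fst ((E₀.prod E₀).prod (E₀.prod E₀)) (E₀.prod E₀) ≫
              AbelianVariety.prodLift
                (AbelianVariety.fst (E₀.prod E₀) (E₀.prod E₀) ≫
                  AbelianVariety.prodLift (AbelianVariety.fst E₀ E₀ ≫ ψ₀) (AbelianVariety.snd E₀ E₀ ≫ (-ψ₀)))
                (AbelianVariety.snd (E₀.prod E₀) (E₀.prod E₀) ≫
                  AbelianVariety.prodLift (AbelianVariety.fst E₀ E₀ ≫ ψ₀) (AbelianVariety.snd E₀ E₀ ≫ (-ψ₀))))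
            (AbelianVariety.snd ((E₀.prod E₀).prod (E₀.prod E₀)) (E₀.prod E₀) ≫
              AbelianVariety.prodLift (AbelianVariety.fst E₀ E₀ ≫ ψ₀) (AbelianVariety.snd E₀ E₀ ≫ (-ψ₀))))
        (AbelianVariety.snd (((E₀.prod E₀).prod (E₀.prod E₀)).prod (E₀.prod E₀)) (E₀.prod E₀) ≫
          AbelianVariety.prodLift (AbelianVariety.fst E₀ E₀ ≫ ψ₀) (AbelianVariety.snd E₀ E₀ ≫ (-ψ₀)))) :
    ∃ (e : ProjectiveEmbedding ((((E₀.prod E₀).prod (E₀.prod E₀)).prod (E₀.prod E₀)).prod (E₀.prod E₀)).X)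
      (a : complexBetti (projectiveSpace e.n ℂ) 2)
      (w : complexBetti ((((E₀.prod E₀).prod (E₀.prod E₀)).prod (E₀.prod E₀)).prod (E₀.prod E₀)).X (2 * 4)),
      IsRationalClass a ∧ a ≠ 0 ∧
      IsHyperbolicWeilType _ Ψ 4
        ((d : ℂ) • complexBetti.map e.ι 2 a + complexBetti.map Ψ.hom.hom.hom 2 (complexBetti.map e.ι 2 a)) ∧
      w ∈ weilClassesOf _ Ψ 4 d ∧ IsRationalClass w ∧ w ≠ 0 ∧
      HasSeedOn 𝒪 4 ((((E₀.prod E₀).prod (E₀.prod E₀)).prod (E₀.prod E₀)).prod (E₀.prod E₀))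
        ((d : ℂ) • complexBetti.map e.ι 2 a + complexBetti.map Ψ.hom.hom.hom 2 (complexBetti.map e.ι 2 a)) w := by
  obtain ⟨hP8, hsq, ⟨e, a, ha, ha0, hhyp⟩, ⟨w, hwQ, hwH, hwW, hw0⟩⟩ := pad4Anchor_hyperbolic_weilClass hE hd hψ Ψ hΨ
  have hwalg := pad4Anchor_hodgeClass_mem_algebraicClasses hE hwQ hwH
  obtain ⟨eK, aK, μ, haK, haK0, hμ, hcl⟩ := exists_projectiveEmbedding_symmetrised hd hsq e ha ha0
  -- abbreviations (terms, not definitions)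
  set η := complexBetti.map e.ι 2 a with hη
  set h := (d : ℂ) • η + complexBetti.map Ψ.hom.hom.hom 2 η with hh
  set ηK := complexBetti.map eK.ι 2 aK with hηK
  -- `Ψ^* Ψ^* = d²` on `H²`, hence `Ψ^* h = d • h`
  have hΨΨ : ∀ x,
      complexBetti.map Ψ.hom.hom.hom 2 (complexBetti.map Ψ.hom.hom.hom 2 x) = ((d : ℂ) ^ 2) • x := by
    intro x
    have hcomp : Ψ.hom.hom.hom ≫ Ψ.hom.hom.hom = (Ψ ≫ Ψ).hom.hom.hom := rfl
    rw [← map_comp_apply', hcomp, hsq, complexBetti_map_neg_nsmul_id_two]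
  have hΨh : complexBetti.map Ψ.hom.hom.hom 2 h = (d : ℂ) • h := by
    rw [hh, map_add, map_smul, hΨΨ, smul_add, smul_smul, ← pow_two, add_comm]
  -- the `K`-symmetrised class of the re-embedding is `2dμ • h = 2d • ηK`
  have hηKh : ηK = ((μ : ℚ) : ℂ) • h := hcl
  have hsymK : (d : ℂ) • ηK + complexBetti.map Ψ.hom.hom.hom 2 ηK = ((2 * d : ℕ) : ℂ) • ηK := by
    rw [hηKh, map_smul, hΨh, smul_smul, smul_smul, ← add_smul, smul_smul]
    congr 1
    push_cast
    ring
  have h2d : ((2 * d : ℕ) : ℂ) ≠ 0 := by exact_mod_cast (by omega : 2 * d ≠ 0)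
  have h2dμ : ((2 * d : ℕ) : ℂ) * ((μ : ℚ) : ℂ) ≠ 0 := mul_ne_zero h2d (by exact_mod_cast hμ)
  -- hyperbolicity for the re-embedded class
  have hhypK : IsHyperbolicWeilType _ Ψ 4 ((d : ℂ) • ηK + complexBetti.map Ψ.hom.hom.hom 2 ηK) := by
    rw [hsymK, hηKh, smul_smul]
    exact (isHyperbolicWeilType_smul_iff h2dμ).2 hhyp
  -- the named fact, applied to `κ₀ = (0, …, 0, w, 0, …)` and `(eK, aK)`
  have hX := isSmoothProjective_of_dim_eq' hP8
  set κ₀ := Pi.single (M := fun p : ℕ ↦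
    complexBetti ((((E₀.prod E₀).prod (E₀.prod E₀)).prod (E₀.prod E₀)).prod (E₀.prod E₀)).X (2 * p)) 4 w with hκ₀
  have hκ₀Q : ∀ p, IsRationalClass (κ₀ p) := by
    intro p
    by_cases hp : p = 4
    · subst hp; rw [hκ₀, Pi.single_eq_same]; exact hwQ
    · rw [hκ₀, Pi.single_eq_of_ne hp]; exact IsRationalClass.zero
  have hκ₀A : ∀ p, κ₀ p ∈ algebraicClasses _ p := by
    intro p
    by_cases hp : p = 4
    · subst hp; rw [hκ₀, Pi.single_eq_same]; exact hwalg
    · rw [hκ₀, Pi.single_eq_of_ne hp]; exact Submodule.zero_mem _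
  obtain ⟨F, hF, N, c, hN, hch⟩ := hK C hX eK aK haK haK0 κ₀ hκ₀Q hκ₀A
  -- the witnesses `(eK, aK, N • w)` and the seed `(range 9, ch(F), c₄/(2d)⁴, c_p/(2d)ᵖ)`
  have hNQ : IsRationalClass ((N : ℂ) • w) := by
    have := hwQ.smul (N : ℚ)
    rwa [Rat.cast_natCast] at this
  have hN0 : (N : ℂ) ≠ 0 := by exact_mod_cast hN.ne'
  have hscal : ∀ p : ℕ,
      (((c p / (2 * d : ℕ) ^ p : ℚ) : ℚ) : ℂ) • cupPowTwo ((d : ℂ) • ηK + complexBetti.map Ψ.hom.hom.hom 2 ηK) p =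
        ((c p : ℚ) : ℂ) • cupPowTwo ηK p := by
    intro p
    have h2dp : ((2 * d : ℕ) : ℂ) ^ p ≠ 0 := pow_ne_zero p h2d
    rw [hsymK, cupPowTwo_smul, smul_smul, Rat.cast_div, Rat.cast_pow, Rat.cast_natCast, div_mul_cancel₀ _ h2dp]
  refine ⟨eK, aK, (N : ℂ) • w, haK, haK0, hhypK, Submodule.smul_mem _ _ hwW, hNQ, smul_ne_zero hN0 hw0, ?_⟩
  refine ⟨Finset.range (2 * 4 + 1), fun p ↦ C.ch _ F p, c 4 / (2 * d : ℕ) ^ 4,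
    fun p ↦ c p / (2 * d : ℕ) ^ p, by simp, ?_, ?_, ?_⟩
  · exact h𝒪 _ _ _ rfl ⟨_, ⟨Iso.refl _⟩⟩ ⟨F, hF, fun _ _ ↦ rfl⟩
  · beta_reduce
    rw [hch 4, hscal 4, hκ₀, Pi.single_eq_same, add_comm]
  · intro p _ hp4
    beta_reduce
    rw [hch p, hscal p, hκ₀, Pi.single_eq_of_ne hp4, smul_zero, zero_add]

end Seed

end Summit.HodgeConjecture.HodgeConjecture.Theorems

end
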